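import Mathlib
import Summits.KontsevichZagierPeriods.Zeta5Search.BrickMultiplierLocalityTwo

/-!
# BrickWeightDescentTwo — the WEIGHT side of the `p = 2` reduction: the block weight `W` and the hole weight `G` of a
2-ADMISSIBLE weight are `2·ω`, `2^A·γ` with `ω`, `γ` again 2-admissible one level down (cell `pub-zeta5`, seat ct-1 g43)

HONEST FRAMING: systematic search; no irrationality claim unless certified.  INSTRUMENT lemmas about the chain's
`BrickLevelReduction.blockWeight A B 0 2 n₀ N g` and `BrickHoleWeight.holeWeight A B 0 2 0 N g` (the weights of the one-level
reduction at `2`, `BrickLevelReductionTwo`); nothing about `ζ(5)`/`ζ(3)`; no `γ`/record statement; records in print UNMOVED;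
NOTHING IS DISCHARGED here (net named-fact debt 0).

THE CLASS.  A weight `g` on the row `M` is 2-ADMISSIBLE AT LEVEL `ℓ` when
(I) `g(k) ∈ ℤ_(2)` (`k ≤ M`); (S) `g(M−k) + g(k) = 0` EXACTLY; (D⁺) `2^e ∣ k − k′ ⇒ v₂(g(k′) − g(k)) ≤ exp(−(e+1))` for
every `0 ≤ e ≤ ℓ` — one factor `2` more than the odd-prime chain's (D) (`BrickBlockWeight`), and `e = 0` included.  The weight
`k ↦ M − 2k` of `Zudilin2002IntegralityCentreFree.integrality_of_propositionH_two` is 2-admissible at every level.  On an EVEN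
row (S) gives `g(M/2) = 0` and (D⁺)₀ then makes EVERY `g(k)` even (`even_row_le`) — the parity `BrickBlockWeightTwo` isolated.

THE STATEMENTS (`A` even, `1 ≤ B`, `2B ≤ A`; hypotheses (I), (S), (D⁺) at level `L+1` on the row):
* odd row `2N+1` (`W = blockWeight A B 0 2 1 N g`): `blockWeight_two_odd_eq` — **`W(K) = G₁(K) − G₁(N−K)`**,
  `G₁(K) = g(2K+1)·λ₁(K)` (the even-pole multiplier is `λ₁(N−K)` by even-`A` reflection, and `g(2K) = −g(2(N−K)+1)`); hence
  `blockWeight_two_odd_reflect` (`W(N−K) + W(K) = 0` exactly) and **`blockWeight_two_odd_local`**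
  (`2^e ∣ K − K′, e ≤ L ⇒ v₂(W(K′) − W(K)) ≤ exp(−(e+2))`: `λ₁ = 2^B·ψ·(−(K+N+1))^B` with `ψ` digit-local,
  `BrickMultiplierLocalityTwo.exists_psi_two_odd_odd`; for `B = 1` the two polynomial increments `∓(K′−K)` PAIR into
  `2(K−K′)·(g(2K+1)ψ(K) − g(2K)ψ(N−K)) ≡ 0 (mod 2^{e+2})`); with `blockWeight_two_odd_le` (`v₂(W) ≤ exp(−B)`, g42) `ω = W/2`
  is 2-admissible at level `L` on the row `N`;
* even row `2N+2` (`W = blockWeight A B 0 2 0 (N+1) g`, `G = holeWeight A B 0 2 0 N g`): `even_row_le` (every `g(k)` is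
  even), `blockWeight_two_even_eq_brickPhi` (`W(K) = g(2K)·Φ_{N+1,2}(−K)`), `blockWeight_two_even_reflect`,
  **`blockWeight_two_even_local`** (`exp(−(e+2))`, by `BrickPhiAllPrimes.padicValuation_brickPhi_sub_le_succ` and the evenness
  of `g`); `holeWeight_two_eq`, `holeWeight_two_reflect`, **`holeWeight_two_local`** (`exp(−(A+e+1))`, by
  `exists_hat_two`): `ω = W/2` on the row `N+1` and `γ = G/2^A` on the row `N` are 2-admissible at level `L`.
DATA (seat desk `alg/classprobe.py`, exact): along the whole descent tree of `M − 2k` for `(6,1,0)`, roots `M ≤ 100` (1,985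
weights), (I), (S), (D⁺) hold with margin exactly `1` — the class is tight.  Theorems only (0 `def`); tree vocabulary.
-/

namespace Summit.KontsevichZagierPeriods.Zeta5Search.BrickWeightDescentTwo

open Finset Nat WithZero
open Summit.KontsevichZagierPeriods.Zeta5Search.BrickTopCoefficient (cTop)
open Summit.KontsevichZagierPeriods.Zeta5Search.BrickKernelFrobenius (brickPhi)
open Summit.KontsevichZagierPeriods.Zeta5Search.BrickLaurent (phiCoeff)
open Summit.KontsevichZagierPeriods.Zeta5Search.BrickLambda (cTop_zero_ne_zero)
open Summit.KontsevichZagierPeriods.Zeta5Search.BrickLambdaDigit (cTop_zero_reflect)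
open Summit.KontsevichZagierPeriods.Zeta5Search.BrickLevelReduction (blockWeight)
open Summit.KontsevichZagierPeriods.Zeta5Search.BrickHoleWeight (holeWeight)
open Summit.KontsevichZagierPeriods.Zeta5Search.BrickPhiAllPrimes (phiCoeff_zero_eq_sign padicValuation_brickPhi_neg_eq_one'
  padicValuation_brickPhi_sub_le_succ brickPhi_neg_sub_natCast_of_even)
open Summit.KontsevichZagierPeriods.Zeta5Search.BrickResidueLawTwo (padicValuation_two padicValuation_two_pow)
open Summit.KontsevichZagierPeriods.Zeta5Search.BrickBlockWeightTwo (blockWeight_two_even_eq)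
open Summit.KontsevichZagierPeriods.Zeta5Search.BrickMultiplierLocalityTwo (exists_psi_two_odd_odd exists_hat_two
  padicValuation_intCast_le_of_dvd)

noncomputable section

/-- `2^e ∣ K − K′ ⇒ v₂(K − K′) ≤ exp(−e)` for the rational difference of two naturals. -/
theorem padicValuation_natCast_sub_le {K K' e : ℕ} (h : (2 : ℤ) ^ e ∣ (K : ℤ) - K') :
    Rat.padicValuation 2 ((K : ℚ) - K') ≤ exp (-(e : ℤ)) := by
  have := padicValuation_intCast_le_of_dvd h
  push_cast at this
  exact this

/-! ## Odd row `2N+1` -/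

section odd

variable {A B N L : ℕ} (hA : Even A) (hB : 1 ≤ B) (hAB : 2 * B ≤ A) {g : ℕ → ℚ}
  (hgI : ∀ k, k ≤ 2 * N + 1 → Rat.padicValuation 2 (g k) ≤ 1)
  (hgS : ∀ k, k ≤ 2 * N + 1 → g (2 * N + 1 - k) + g k = 0)
  (hgD : ∀ e k k', e ≤ L + 1 → k ≤ 2 * N + 1 → k' ≤ 2 * N + 1 → (2 : ℤ) ^ e ∣ (k : ℤ) - k' →
    Rat.padicValuation 2 (g k' - g k) ≤ exp (-((e : ℤ) + 1)))

include hA hgS in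
/-- **`W(K) = G₁(K) − G₁(N−K)`** on an odd row: for `A` even, `g` exactly antisymmetric on `[0, 2N+1]` and `K ≤ N`,
`blockWeight A B 0 2 1 N g K = g(2K+1)·λ₁(K) − g(2(N−K)+1)·λ₁(N−K)`, `λ₁(K) = c̃_{2K+1,A}(2N+1)/c̃_{K,A}(N)` (the even pole
`2K = (2N+1) − (2(N−K)+1)` carries the multiplier `λ₁(N−K)` by `cTop_zero_reflect`, and `g(2K) = −g(2(N−K)+1)`). -/
theorem blockWeight_two_odd_eq {K : ℕ} (hK : K ≤ N) :
    blockWeight A B 0 2 1 N g K =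
      g (2 * K + 1) * (cTop A B 0 (2 * N + 1) (2 * K + 1) / cTop A B 0 N K) -
        g (2 * (N - K) + 1) * (cTop A B 0 (2 * N + 1) (2 * (N - K) + 1) / cTop A B 0 N (N - K)) := by
  rw [blockWeight, Finset.sum_range_succ, Finset.sum_range_one, zero_add, show 1 + N * 2 = 2 * N + 1 by ring,
    show K * 2 = 2 * K by ring, show 1 + 2 * K = 2 * K + 1 by ring]
  have h1 : cTop A B 0 (2 * N + 1) (2 * K) = cTop A B 0 (2 * N + 1) (2 * (N - K) + 1) := by
    rw [← cTop_zero_reflect hA B (by omega : 2 * (N - K) + 1 ≤ 2 * N + 1)]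
    congr 1; omega
  have h2 : cTop A B 0 N K = cTop A B 0 N (N - K) := by
    rw [← cTop_zero_reflect hA B (Nat.sub_le N K)]; congr 1; omega
  have h3 : g (2 * K) = -g (2 * (N - K) + 1) := by
    have h := hgS (2 * K) (by omega)
    rw [show 2 * N + 1 - 2 * K = 2 * (N - K) + 1 by omega] at h
    linarith
  rw [h1, h3, ← h2]
  ring

include hA hgS in
/-- **Exact antisymmetry of the block weight on an odd row**: `W(N−K) + W(K) = 0` for `K ≤ N`. -/
theorem blockWeight_two_odd_reflect {K : ℕ} (hK : K ≤ N) :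
    blockWeight A B 0 2 1 N g (N - K) + blockWeight A B 0 2 1 N g K = 0 := by
  rw [blockWeight_two_odd_eq hA hgS hK, blockWeight_two_odd_eq hA hgS (Nat.sub_le N K),
    show N - (N - K) = K by omega]
  ring

include hA hB hAB hgI hgS hgD in
/-- **Digit-locality of the block weight on an odd row, one factor `2` to spare**: for `e ≤ L`, `K, K′ ≤ N` with
`2^e ∣ K − K′`: `v₂(W(K′) − W(K)) ≤ exp(−(e+2))` — so `ω = W/2` satisfies (D⁺) at level `L`. -/
theorem blockWeight_two_odd_local {e K K' : ℕ} (he : e ≤ L) (hK : K ≤ N) (hK' : K' ≤ N)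
    (hdvd : (2 : ℤ) ^ e ∣ (K : ℤ) - K') :
    Rat.padicValuation 2 (blockWeight A B 0 2 1 N g K' - blockWeight A B 0 2 1 N g K) ≤ exp (-((e : ℤ) + 2)) := by
  obtain ⟨ψ, hψ, hψI, hψD⟩ := exists_psi_two_odd_odd hAB N
  -- the unit part `a(K) = g(2K+1)·ψ(K)` and the polynomial part `P(K) = (−(K+N+1))^B`
  set a : ℕ → ℚ := fun K => g (2 * K + 1) * ψ K with ha
  set P : ℕ → ℚ := fun K => (-((K : ℚ) + N + 1)) ^ B with hP
  have haI : ∀ K, K ≤ N → Rat.padicValuation 2 (a K) ≤ 1 := fun K hK => by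
    rw [ha]; simp only; rw [map_mul]; exact mul_le_one' (hgI _ (by omega)) (hψI K)
  have hPI : ∀ K, Rat.padicValuation 2 (P K) ≤ 1 := fun K => by
    rw [hP]; simp only
    rw [show (-((K : ℚ) + N + 1)) ^ B = (((-((K : ℤ) + N + 1)) ^ B : ℤ) : ℚ) by push_cast; ring, Rat.padicValuation_cast]
    exact Int.padicValuation_le_one _ _
  -- `a` is digit-local with exponent `e+1`
  have haD : ∀ K K', K ≤ N → K' ≤ N → (2 : ℤ) ^ e ∣ (K : ℤ) - K' →
      Rat.padicValuation 2 (a K' - a K) ≤ exp (-((e : ℤ) + 1)) := fun K K' hK hK' hd => by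
    rw [ha]; simp only
    rw [show g (2 * K' + 1) * ψ K' - g (2 * K + 1) * ψ K =
      g (2 * K' + 1) * (ψ K' - ψ K) + (g (2 * K' + 1) - g (2 * K + 1)) * ψ K by ring]
    refine (Valuation.map_add _ _ _).trans (max_le ?_ ?_) <;> rw [map_mul]
    · calc _ ≤ 1 * exp (-((e : ℤ) + 1)) := mul_le_mul' (hgI _ (by omega)) (hψD e K K' hd)
        _ = _ := one_mul _
    · have h := hgD (e + 1) (2 * K + 1) (2 * K' + 1) (by omega) (by omega) (by omega)
        (by rw [pow_succ]; push_cast; rw [show (2 * (K : ℤ) + 1) - (2 * K' + 1) = (K - K') * 2 by ring]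
            exact mul_dvd_mul hd dvd_rfl)
      calc _ ≤ exp (-(((e + 1 : ℕ) : ℤ) + 1)) * 1 := mul_le_mul' h (hψI K)
        _ ≤ _ := by rw [mul_one, exp_le_exp]; push_cast; omega
  -- `P` is digit-local with exponent `e` (an integer polynomial in `K`)
  have hPD : ∀ K K' : ℕ, (2 : ℤ) ^ e ∣ (K : ℤ) - K' → Rat.padicValuation 2 (P K' - P K) ≤ exp (-(e : ℤ)) :=
    fun K K' hd => by
    have hmod : (K' : ℤ) ≡ K [ZMOD 2 ^ e] := Int.modEq_iff_dvd.2 hd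
    have hmodP : (-((K' : ℤ) + N + 1)) ^ B ≡ (-((K : ℤ) + N + 1)) ^ B [ZMOD 2 ^ e] := by gcongr
    have h := padicValuation_intCast_le_of_dvd hmodP.symm.dvd
    rw [hP]; simp only
    push_cast at h ⊢
    exact h
  -- the `G₁`-form of both block weights
  have hWK := blockWeight_two_odd_eq hA (B := B) hgS hK
  have hWK' := blockWeight_two_odd_eq hA (B := B) hgS hK'
  rw [hψ K hK, hψ (N - K) (Nat.sub_le N K)] at hWK
  rw [hψ K' hK', hψ (N - K') (Nat.sub_le N K')] at hWK'
  have hdvd' : (2 : ℤ) ^ e ∣ ((N - K : ℕ) : ℤ) - ((N - K' : ℕ) : ℤ) := by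
    rw [Nat.cast_sub hK, Nat.cast_sub hK', show ((N : ℤ) - K) - (N - K') = -((K : ℤ) - K') by ring]
    exact (dvd_neg).2 hdvd
  have key : blockWeight A B 0 2 1 N g K' - blockWeight A B 0 2 1 N g K =
      (2 : ℚ) ^ B * ((a K' - a K) * P K' - (a (N - K') - a (N - K)) * P (N - K')) +
        (2 : ℚ) ^ B * (a K * (P K' - P K) - a (N - K) * (P (N - K') - P (N - K))) := by
    rw [hWK, hWK', ha, hP]; push_cast; ring
  rw [key]
  have h2B : Rat.padicValuation 2 ((2 : ℚ) ^ B) = exp (-(B : ℤ)) := padicValuation_two_pow B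
  refine (Valuation.map_add _ _ _).trans (max_le ?_ ?_) <;> rw [map_mul, h2B]
  · -- the unit parts: `2^B·2^{e+1}`
    have h1 : Rat.padicValuation 2 ((a K' - a K) * P K' - (a (N - K') - a (N - K)) * P (N - K')) ≤
        exp (-((e : ℤ) + 1)) := by
      refine (Valuation.map_sub _ _ _).trans (max_le ?_ ?_) <;> rw [map_mul]
      · calc _ ≤ exp (-((e : ℤ) + 1)) * 1 := mul_le_mul' (haD K K' hK hK' hdvd) (hPI K')
          _ = _ := mul_one _
      · calc _ ≤ exp (-((e : ℤ) + 1)) * 1 :=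
            mul_le_mul' (haD (N - K) (N - K') (Nat.sub_le N K) (Nat.sub_le N K') hdvd') (hPI _)
          _ = _ := mul_one _
    calc _ ≤ exp (-(B : ℤ)) * exp (-((e : ℤ) + 1)) := mul_le_mul' le_rfl h1
      _ ≤ _ := by rw [← exp_add, exp_le_exp]; omega
  · -- the polynomial parts: `2^B·2^e` suffices for `B ≥ 2`; for `B = 1` the two increments pair
    rcases Nat.lt_or_ge 1 B with hB2 | hB1
    · have h1 : Rat.padicValuation 2 (a K * (P K' - P K) - a (N - K) * (P (N - K') - P (N - K))) ≤
          exp (-(e : ℤ)) := by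
        refine (Valuation.map_sub _ _ _).trans (max_le ?_ ?_) <;> rw [map_mul]
        · calc _ ≤ 1 * exp (-(e : ℤ)) := mul_le_mul' (haI K hK) (hPD K K' hdvd)
            _ = _ := one_mul _
        · calc _ ≤ 1 * exp (-(e : ℤ)) := mul_le_mul' (haI (N - K) (Nat.sub_le N K)) (hPD _ _ hdvd')
            _ = _ := one_mul _
      calc _ ≤ exp (-(B : ℤ)) * exp (-(e : ℤ)) := mul_le_mul' le_rfl h1
        _ ≤ _ := by rw [← exp_add, exp_le_exp]; omega
    · have hB1 : B = 1 := le_antisymm hB1 hB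
      subst hB1
      have hPair : a K * (P K' - P K) - a (N - K) * (P (N - K') - P (N - K)) =
          ((K : ℚ) - K') * ((g (2 * K + 1) - g (2 * K)) * ψ K + g (2 * K) * (ψ K - ψ (N - K))) := by
        have h3 : g (2 * (N - K) + 1) = -g (2 * K) := by
          have h := hgS (2 * K) (by omega)
          rw [show 2 * N + 1 - 2 * K = 2 * (N - K) + 1 by omega] at h
          linarith
        rw [ha, hP]; simp only
        rw [h3, Nat.cast_sub hK, Nat.cast_sub hK']
        ring
      rw [hPair, map_mul]
      have hpar : Rat.padicValuation 2 ((g (2 * K + 1) - g (2 * K)) * ψ K + g (2 * K) * (ψ K - ψ (N - K))) ≤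
          exp (-1 : ℤ) := by
        refine (Valuation.map_add _ _ _).trans (max_le ?_ ?_) <;> rw [map_mul]
        · have h := hgD 0 (2 * K) (2 * K + 1) (Nat.zero_le _) (by omega) (by omega) (by rw [pow_zero]; exact one_dvd _)
          rw [Nat.cast_zero, zero_add] at h
          calc _ ≤ exp (-1 : ℤ) * 1 := mul_le_mul' h (hψI K)
            _ = _ := mul_one _
        · have h := hψD 0 (N - K) K (by rw [pow_zero]; exact one_dvd _)
          rw [Nat.cast_zero, zero_add] at h
          calc _ ≤ 1 * exp (-1 : ℤ) := mul_le_mul' (hgI _ (by omega)) h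
            _ = _ := one_mul _
      calc _ ≤ exp (-((1 : ℕ) : ℤ)) * (exp (-(e : ℤ)) * exp (-1 : ℤ)) :=
          mul_le_mul' le_rfl (mul_le_mul' (padicValuation_natCast_sub_le hdvd) hpar)
        _ ≤ _ := by rw [← exp_add, ← exp_add, exp_le_exp]; push_cast; omega

end odd

/-! ## Even row `2N+2` -/

section even

variable {A B N L : ℕ} (hA : Even A) (hAB : 2 * B ≤ A) {g : ℕ → ℚ}
  (hgI : ∀ k, k ≤ 2 * N + 2 → Rat.padicValuation 2 (g k) ≤ 1)
  (hgS : ∀ k, k ≤ 2 * N + 2 → g (2 * N + 2 - k) + g k = 0)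
  (hgD : ∀ e k k', e ≤ L + 1 → k ≤ 2 * N + 2 → k' ≤ 2 * N + 2 → (2 : ℤ) ^ e ∣ (k : ℤ) - k' →
    Rat.padicValuation 2 (g k' - g k) ≤ exp (-((e : ℤ) + 1)))

include hgS hgD in
/-- **On an even row every value of a 2-admissible weight is even**: `g(N+1) = 0` by (S), and (D⁺)₀ makes `g` constant
mod `2`. -/
theorem even_row_le {k : ℕ} (hk : k ≤ 2 * N + 2) : Rat.padicValuation 2 (g k) ≤ exp (-1 : ℤ) := by
  have h0 : g (N + 1) = 0 := by
    have h := hgS (N + 1) (by omega)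
    rw [show 2 * N + 2 - (N + 1) = N + 1 by omega] at h
    linarith
  have h := hgD 0 (N + 1) k (Nat.zero_le _) (by omega) hk (by rw [pow_zero]; exact one_dvd _)
  rwa [h0, sub_zero, Nat.cast_zero, zero_add] at h

include hAB in
/-- **`W(K) = g(2K)·Φ_{N+1,2}(−K)`** on the even row `2N+2 = (N+1)·2` (`K ≤ N+1`): g42's `blockWeight_two_even_eq` with the
two signs `(−1)^{(N+1)B}` cancelled by `BrickPhiAllPrimes.phiCoeff_zero_eq_sign`. -/
theorem blockWeight_two_even_eq_brickPhi {K : ℕ} (hK : K ≤ N + 1) :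
    blockWeight A B 0 2 0 (N + 1) g K = g (2 * K) * brickPhi A B 2 (N + 1) (-(K : ℚ)) := by
  rw [blockWeight_two_even_eq hAB hK, phiCoeff_zero_eq_sign Nat.prime_two, Int.cast_natCast,
    show (N + 1) * (2 - 1) * B = (N + 1) * B by norm_num, ← mul_assoc ((-1 : ℚ) ^ ((N + 1) * B)), ← pow_add, ← two_mul,
    pow_mul, neg_one_sq, one_pow, one_mul]

include hA hAB hgS in
/-- **Exact antisymmetry of the block weight on an even row**: `W(N+1−K) + W(K) = 0` (`K ≤ N+1`; even-`A` reflection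
`Φ_{N+1,2}(−(N+1−K)) = Φ_{N+1,2}(−K)`, `BrickPhiAllPrimes.brickPhi_neg_sub_natCast_of_even`). -/
theorem blockWeight_two_even_reflect {K : ℕ} (hK : K ≤ N + 1) :
    blockWeight A B 0 2 0 (N + 1) g (N + 1 - K) + blockWeight A B 0 2 0 (N + 1) g K = 0 := by
  rw [blockWeight_two_even_eq_brickPhi hAB hK, blockWeight_two_even_eq_brickPhi hAB (Nat.sub_le _ _),
    brickPhi_neg_sub_natCast_of_even (by norm_num : 0 < 2) hA B hK]
  have h := hgS (2 * K) (by omega)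
  rw [show 2 * N + 2 - 2 * K = 2 * (N + 1 - K) by omega] at h
  rw [← add_mul, h, zero_mul]

include hAB hgS hgD in
/-- **Digit-locality of the block weight on an even row, one factor `2` to spare**: for `e ≤ L`, `K, K′ ≤ N+1` with
`2^e ∣ K − K′`: `v₂(W(K′) − W(K)) ≤ exp(−(e+2))` (`g(2K′)` is even and `Φ` is digit-local with exponent `e+1`;
`g(2K′) − g(2K)` is divisible by `2^{e+2}` and `Φ(−K)` is a unit). -/
theorem blockWeight_two_even_local {e K K' : ℕ} (he : e ≤ L) (hK : K ≤ N + 1) (hK' : K' ≤ N + 1)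
    (hdvd : (2 : ℤ) ^ e ∣ (K : ℤ) - K') :
    Rat.padicValuation 2 (blockWeight A B 0 2 0 (N + 1) g K' - blockWeight A B 0 2 0 (N + 1) g K) ≤
      exp (-((e : ℤ) + 2)) := by
  rw [blockWeight_two_even_eq_brickPhi hAB hK, blockWeight_two_even_eq_brickPhi hAB hK',
    show g (2 * K') * brickPhi A B 2 (N + 1) (-(K' : ℚ)) - g (2 * K) * brickPhi A B 2 (N + 1) (-(K : ℚ)) =
      g (2 * K') * (brickPhi A B 2 (N + 1) (-((K' : ℤ) : ℚ)) - brickPhi A B 2 (N + 1) (-((K : ℤ) : ℚ))) +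
        (g (2 * K') - g (2 * K)) * brickPhi A B 2 (N + 1) (-((K : ℤ) : ℚ)) by push_cast; ring]
  refine (Valuation.map_add _ _ _).trans (max_le ?_ ?_) <;> rw [map_mul]
  · calc _ ≤ exp (-1 : ℤ) * exp (-((e + 1 : ℕ) : ℤ)) :=
        mul_le_mul' (even_row_le hgS hgD (by omega)) (padicValuation_brickPhi_sub_le_succ A B (N + 1) hdvd)
      _ ≤ _ := by rw [← exp_add, exp_le_exp]; push_cast; omega
  · have h := hgD (e + 1) (2 * K) (2 * K') (by omega) (by omega) (by omega)
      (by rw [pow_succ]; push_cast; rw [show (2 * (K : ℤ)) - 2 * K' = (K - K') * 2 by ring]; exact mul_dvd_mul hdvd dvd_rfl)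
    rw [padicValuation_brickPhi_neg_eq_one', mul_one]
    refine h.trans ?_
    rw [exp_le_exp]; push_cast; omega

/-- **`G(K) = g(2K+1)·μ(K)`**, `μ(K) = c̃_{2K+1,A}(2N+2)/c̃_{K,A}(N)`: the hole weight of the even row `2N+2` on the row `N`
(`K ≤ N`; one hole digit `k₀ = 1`). -/
theorem holeWeight_two_eq (A B N : ℕ) (g : ℕ → ℚ) (K : ℕ) :
    holeWeight A B 0 2 0 N g K = g (2 * K + 1) * (cTop A B 0 (2 * N + 2) (2 * K + 1) / cTop A B 0 N K) := by
  rw [holeWeight, zero_add, Nat.Ico_succ_singleton, Finset.sum_singleton, zero_add, show (N + 1) * 2 = 2 * N + 2 by ring,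
    show 1 + K * 2 = 2 * K + 1 by ring]

include hA hgS in
/-- **Exact antisymmetry of the hole weight**: `G(N−K) + G(K) = 0` for `K ≤ N` (`μ(N−K) = μ(K)` by `cTop_zero_reflect` on
both rows, `g(2(N−K)+1) = −g(2K+1)`). -/
theorem holeWeight_two_reflect {K : ℕ} (hK : K ≤ N) :
    holeWeight A B 0 2 0 N g (N - K) + holeWeight A B 0 2 0 N g K = 0 := by
  rw [holeWeight_two_eq, holeWeight_two_eq]
  have h1 : cTop A B 0 (2 * N + 2) (2 * (N - K) + 1) = cTop A B 0 (2 * N + 2) (2 * K + 1) := by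
    rw [← cTop_zero_reflect hA B (by omega : 2 * K + 1 ≤ 2 * N + 2)]; congr 1; omega
  have h2 : cTop A B 0 N (N - K) = cTop A B 0 N K := cTop_zero_reflect hA B hK
  have h3 : g (2 * (N - K) + 1) = -g (2 * K + 1) := by
    have h := hgS (2 * K + 1) (by omega)
    rw [show 2 * N + 2 - (2 * K + 1) = 2 * (N - K) + 1 by omega] at h
    linarith
  rw [h1, h2, h3]
  ring

include hAB hgS hgD in
/-- **Digit-locality of the hole weight, `A + 1` factors `2` to spare**: for `e ≤ L`, `K, K′ ≤ N` with `2^e ∣ K − K′`: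
`v₂(G(K′) − G(K)) ≤ exp(−(A+e+1))` (`μ = 2^A·ĥ·Q` with `ĥ` digit-local, `Q` an integer polynomial in `K`, and `g` even on the
row) — so `γ = G/2^A` satisfies (D⁺) at level `L`. -/
theorem holeWeight_two_local {e K K' : ℕ} (he : e ≤ L) (hK : K ≤ N) (hK' : K' ≤ N)
    (hdvd : (2 : ℤ) ^ e ∣ (K : ℤ) - K') :
    Rat.padicValuation 2 (holeWeight A B 0 2 0 N g K' - holeWeight A B 0 2 0 N g K) ≤ exp (-((A : ℤ) + e + 1)) := by
  obtain ⟨ĥ, hĥ, hĥI, hĥD⟩ := exists_hat_two hAB N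
  set Q : ℕ → ℚ := fun K => ((-((K : ℚ) + N + 1)) * ((((2 * N + 1 : ℕ) : ℚ) - K))) ^ B with hQ
  have hQI : ∀ K, Rat.padicValuation 2 (Q K) ≤ 1 := fun K => by
    rw [hQ]; simp only
    rw [show ((-((K : ℚ) + N + 1)) * ((((2 * N + 1 : ℕ) : ℚ) - K))) ^ B =
      ((((-((K : ℤ) + N + 1)) * ((2 * N + 1 : ℕ) - K)) ^ B : ℤ) : ℚ) by push_cast; ring, Rat.padicValuation_cast]
    exact Int.padicValuation_le_one _ _
  have hQD : Rat.padicValuation 2 (Q K' - Q K) ≤ exp (-(e : ℤ)) := by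
    have hmod : (K' : ℤ) ≡ K [ZMOD 2 ^ e] := Int.modEq_iff_dvd.2 hdvd
    have hmodQ : ((-((K' : ℤ) + N + 1)) * ((2 * N + 1 : ℕ) - K')) ^ B ≡
        ((-((K : ℤ) + N + 1)) * ((2 * N + 1 : ℕ) - K)) ^ B [ZMOD 2 ^ e] := by gcongr
    have h := padicValuation_intCast_le_of_dvd hmodQ.symm.dvd
    rw [hQ]; simp only
    push_cast at h ⊢
    exact h
  have hμ : ∀ K, K ≤ N → cTop A B 0 (2 * N + 2) (2 * K + 1) / cTop A B 0 N K = (2 : ℚ) ^ A * ĥ K * Q K :=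
    fun K hK => by rw [hĥ K hK]
  rw [holeWeight_two_eq, holeWeight_two_eq, hμ K hK, hμ K' hK',
    show g (2 * K' + 1) * ((2 : ℚ) ^ A * ĥ K' * Q K') - g (2 * K + 1) * ((2 : ℚ) ^ A * ĥ K * Q K) =
      (2 : ℚ) ^ A * (g (2 * K' + 1) * ((ĥ K' - ĥ K) * Q K' + ĥ K * (Q K' - Q K)) +
        (g (2 * K' + 1) - g (2 * K + 1)) * (ĥ K * Q K)) by ring, map_mul, padicValuation_two_pow]
  have hg' : Rat.padicValuation 2 (g (2 * K' + 1)) ≤ exp (-1 : ℤ) := even_row_le hgS hgD (by omega)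
  have hterm : Rat.padicValuation 2 (g (2 * K' + 1) * ((ĥ K' - ĥ K) * Q K' + ĥ K * (Q K' - Q K)) +
      (g (2 * K' + 1) - g (2 * K + 1)) * (ĥ K * Q K)) ≤ exp (-((e : ℤ) + 1)) := by
    refine (Valuation.map_add _ _ _).trans (max_le ?_ ?_) <;> rw [map_mul]
    · have h1 : Rat.padicValuation 2 ((ĥ K' - ĥ K) * Q K' + ĥ K * (Q K' - Q K)) ≤ exp (-(e : ℤ)) := by
        refine (Valuation.map_add _ _ _).trans (max_le ?_ ?_) <;> rw [map_mul]
        · calc _ ≤ exp (-((e : ℤ) + 1)) * 1 := mul_le_mul' (hĥD e K K' hdvd) (hQI K')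
            _ ≤ _ := by rw [mul_one, exp_le_exp]; omega
        · calc _ ≤ 1 * exp (-(e : ℤ)) := mul_le_mul' (hĥI K) hQD
            _ = _ := one_mul _
      calc _ ≤ exp (-1 : ℤ) * exp (-(e : ℤ)) := mul_le_mul' hg' h1
        _ = _ := by rw [← exp_add]; congr 1; ring
    · have h := hgD (e + 1) (2 * K + 1) (2 * K' + 1) (by omega) (by omega) (by omega)
        (by rw [pow_succ]; push_cast; rw [show (2 * (K : ℤ) + 1) - (2 * K' + 1) = (K - K') * 2 by ring]
            exact mul_dvd_mul hdvd dvd_rfl)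
      rw [map_mul]
      calc _ ≤ exp (-(((e + 1 : ℕ) : ℤ) + 1)) * (1 * 1) := mul_le_mul' h (mul_le_mul' (hĥI K) (hQI K))
        _ ≤ _ := by rw [mul_one, mul_one, exp_le_exp]; push_cast; omega
  calc _ ≤ exp (-(A : ℤ)) * exp (-((e : ℤ) + 1)) := mul_le_mul' le_rfl hterm
    _ = _ := by rw [← exp_add]; congr 1; ring

end even

end

end Summit.KontsevichZagierPeriods.Zeta5Search.BrickWeightDescentTwo
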